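import Literature.Topology.FourManifolds.Cobordism
import HarnessLib

/-!
# Product cobordisms have diffeomorphic ends (proofs for `Cobordism.lean`)

Trunk T-4MAN (`FourManifolds`).  Discharge of the named fact
`Literature.Topology.FourManifolds.Cobordism.nonempty_diffeomorph_of_isTrivial` stated in
`Literature/Topology/FourManifolds/Cobordism.lean`:

* `Cobordism.nonempty_diffeomorph_of_isTrivial_holds : Cobordism.nonempty_diffeomorph_of_isTrivial`
  — if a cobordism `W` from `M` to `N` is trivial, i.e. there is a diffeomorphism
  `Φ : W ≅ M × [0, 1]` with `Φ (inl x) = (x, 0)` (`Literature.Topology.FourManifolds.Cobordism.IsTrivial`), then `M` and `N` are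
  diffeomorphic.  Milnor, *Lectures on the h-cobordism theorem* (Princeton Math. Notes, 1965):
  §0 ("`W` is diffeomorphic to `V × [0, 1]` and (consequently) `V` is diffeomorphic to `V'`"),
  §1 Def. 1.3/1.5 (triads and cobordisms, `Bd W = V₀ ⊔ V₁`; the product cobordism `M × I` with
  ends `M × 0`, `M × 1`), and §9, where Thm. 9.2 (h-cobordant simply connected closed manifolds
  of dimension `> 5` are diffeomorphic) is read off from Thm. 9.1 (`W ≅ V × [0, 1]`) by exactly
  this step.

## Proof

A diffeomorphism preserves boundaries (Mathlib `Diffeomorph.preimage_boundary`), and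
`∂(M × [0, 1]) = M × {0, 1}` for boundaryless `M` (Mathlib `boundary_product`, `boundary_Icc`).
Since `∂W = inl M ⊔ inr N` (fields `range_inl_union_range_inr`, `disjoint_range` of
`Literature.Topology.FourManifolds.Cobordism`) and `Φ (inl M) = M × {0}`, the diffeomorphism `Φ` maps `inr N` bijectively onto
`M × {1}`.  Hence `g y := (Φ (inr y)).1` is a bijection `N → M` with inverse
`f x := inr⁻¹ (Φ⁻¹ (x, 1))`; `g` is smooth as a composite of smooth maps, and `f` is smooth
because `inr ∘ f = Φ⁻¹ ∘ (·, 1)` is smooth and `inr` is a smooth embedding, i.e. an immersion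
that is a topological embedding (Mathlib `ContMDiff.iff_comp_isImmersion`,
`Topology.IsEmbedding.continuous_iff`).  Only the data of the statement are used (no compactness or
Hausdorff hypothesis enters the argument).
-/

open scoped Manifold ContDiff Topology
open Set Function

noncomputable section

namespace Literature.Topology.FourManifolds

universe u

variable {n : ℕ} {M N : Type u} [TopologicalSpace M] [ChartedSpace (EuclideanSpace ℝ (Fin n)) M]
  [TopologicalSpace N] [ChartedSpace (EuclideanSpace ℝ (Fin n)) N]

/-- **Discharge of `Literature.Topology.FourManifolds.Cobordism.nonempty_diffeomorph_of_isTrivial`: a product cobordism has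
diffeomorphic ends.**  If `Φ : W ≅ M × [0, 1]` is a diffeomorphism with `Φ (inl x) = (x, 0)`, then
`y ↦ (Φ (inr y)).1` is a diffeomorphism `N ≅ M` (so `M ≃ₘ N`): `Φ` carries
`∂W = inl M ⊔ inr N` onto `∂(M × [0, 1]) = M × {0, 1}`, hence `inr N` onto `M × {1}`.  Milnor,
*Lectures on the h-cobordism theorem* (1965), §0, §1 (Def. 1.5, product cobordism `M × I`) and
§9 (Thm. 9.1 ⇒ Thm. 9.2). [cite: MilnorHCobordism1965, §1 Def. 1.5 and §9 Thm. 9.1–9.2] -/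
theorem Cobordism.nonempty_diffeomorph_of_isTrivial_holds :
    Cobordism.nonempty_diffeomorph_of_isTrivial (n := n) (M := M) (N := N) := by
  intro _ _ _ _ _ _ _ _ c hc
  obtain ⟨Φ, hΦ⟩ := hc
  -- `Φ` identifies `∂W = inl M ⊔ inr N` with `∂(M × [0,1]) = M × {0, 1}`.
  have hpre : Φ ⁻¹' ((𝓡 n).prod (𝓡∂ 1)).boundary (M × (Set.Icc (0 : ℝ) 1)) =
      (𝓡∂ (n + 1)).boundary c.W :=
    Φ.preimage_boundary (by simp)
  have hbdP : ((𝓡 n).prod (𝓡∂ 1)).boundary (M × (Set.Icc (0 : ℝ) 1)) = Set.prod univ {⊥, ⊤} :=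
    boundary_product (𝓡 n)
  -- The `N`-end goes to `M × {1}`: `(Φ (inr y)).2 = 1`, since `M × {0} = Φ (inl M)` is disjoint
  -- from `Φ (inr N)`.
  have h2 : ∀ y : N, (Φ (c.inr y)).2 = ⊤ := by
    intro y
    have hy : c.inr y ∈ Φ ⁻¹' ((𝓡 n).prod (𝓡∂ 1)).boundary (M × (Set.Icc (0 : ℝ) 1)) := by
      rw [hpre]; exact c.inr_mem_boundary y
    rw [mem_preimage, hbdP] at hy
    obtain ⟨-, hy | hy⟩ := hy
    · exfalso
      have key : Φ (c.inr y) = Φ (c.inl (Φ (c.inr y)).1) := by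
        rw [hΦ]; exact Prod.ext rfl hy
      exact Set.disjoint_left.mp c.disjoint_range (mem_range_self (Φ (c.inr y)).1)
        ⟨y, EquivLike.injective Φ key⟩
    · exact hy
  -- Conversely every point of `M × {1}` comes from the `N`-end (it is a boundary point, and
  -- `Φ (inl x') = (x', 0) ≠ (x, 1)`).
  have h1 : ∀ x : M, ∃ y : N, c.inr y = Φ.symm (x, ⊤) := by
    intro x
    have hx : Φ.symm (x, ⊤) ∈ (𝓡∂ (n + 1)).boundary c.W := by
      rw [← hpre, mem_preimage, Φ.apply_symm_apply, hbdP]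
      exact ⟨mem_univ _, Or.inr rfl⟩
    rw [← c.range_inl_union_range_inr] at hx
    obtain ⟨x', hx'⟩ | ⟨y, hy⟩ := hx
    · exfalso
      have key : ((x', ⊥) : M × Set.Icc (0 : ℝ) 1) = (x, ⊤) := by
        rw [← hΦ x', hx', Φ.apply_symm_apply]
      have key' := congrArg (fun p : M × Set.Icc (0 : ℝ) 1 => (p.2 : ℝ)) key
      simp only [Set.Icc.coe_bot, Set.Icc.coe_top] at key'
      exact zero_ne_one key'
    · exact ⟨y, hy⟩
  choose f hf using h1
  -- `f : M → N` with `inr (f x) = Φ⁻¹ (x, 1)`; its inverse is `g y = (Φ (inr y)).1`.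
  have hgf : ∀ x, (Φ (c.inr (f x))).1 = x := fun x => by rw [hf, Φ.apply_symm_apply]
  have hfg : ∀ y, f (Φ (c.inr y)).1 = y := fun y => by
    apply c.isSmoothEmbedding_inr.isEmbedding.injective
    rw [hf]
    conv_lhs => rw [← h2 y, Prod.mk.eta]
    exact Φ.symm_apply_apply _
  -- Smoothness: `inr ∘ f = Φ⁻¹ ∘ (·, 1)` is smooth and `inr` is a smooth embedding; `g` is a
  -- composite of smooth maps.
  have hcomp : c.inr ∘ f = Φ.symm ∘ fun x => (x, ⊤) := funext hf
  have hf_smooth : ContMDiff (𝓡 n) (𝓡 n) ∞ f := by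
    rw [ContMDiff.iff_comp_isImmersion c.isSmoothEmbedding_inr.isImmersion, hcomp,
      c.isSmoothEmbedding_inr.isEmbedding.continuous_iff, hcomp]
    exact ⟨Φ.symm.continuous.comp (continuous_id.prodMk continuous_const),
      Φ.symm.contMDiff.comp (contMDiff_id.prodMk contMDiff_const)⟩
  have hg_smooth : ContMDiff (𝓡 n) (𝓡 n) ∞ fun y => (Φ (c.inr y)).1 :=
    (Φ.contMDiff.comp c.isSmoothEmbedding_inr.contMDiff).fst
  exact ⟨{ toEquiv := ⟨f, fun y => (Φ (c.inr y)).1, hgf, hfg⟩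
           contMDiff_toFun := hf_smooth
           contMDiff_invFun := hg_smooth }⟩

end Literature.Topology.FourManifolds
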